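import Summits.RiemannHypothesis.RiemannHypothesis.Theorems.WeilLegendreBlocks136Base
import Summits.RiemannHypothesis.RiemannHypothesis.Theorems.WeilLegendreBlocks136DataDn14
import Literature.NumberTheory.LFunctions.WeilBlockRowsPZ
import HarnessLib

/-!
# Odd Legendre blocks at `nb = 136`: the factored inverse agrees with `D`, rows 24–27

`WeilCert.checkDnRow` for the block base `weilBlocks136Base` with `weilBlocks136Dn/weilBlocks136Ls`, by `decide +kernel`. Pure proof file.
-/

noncomputable section

set_option linter.dupNamespace false

namespace Summit.RiemannHypothesis.RiemannHypothesis.Theorems.EvenWinsBeyondArch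

open Literature.NumberTheory.LFunctions

set_option maxHeartbeats 0 in
/-- Row 24 of `Dn/Ls` is row 24 of `D` (odd blocks, `nb = 136`). [folklore] -/
theorem checkDnRow1_24_weilBlocks136 : weilBlocks136Base.checkDnRow weilBlocks136Dn weilBlocks136Ls 1 24 = true := by
  decide +kernel

set_option maxHeartbeats 0 in
/-- Row 25 of `Dn/Ls` is row 25 of `D` (odd blocks, `nb = 136`). [folklore] -/
theorem checkDnRow1_25_weilBlocks136 : weilBlocks136Base.checkDnRow weilBlocks136Dn weilBlocks136Ls 1 25 = true := by
  decide +kernel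

set_option maxHeartbeats 0 in
/-- Row 26 of `Dn/Ls` is row 26 of `D` (odd blocks, `nb = 136`). [folklore] -/
theorem checkDnRow1_26_weilBlocks136 : weilBlocks136Base.checkDnRow weilBlocks136Dn weilBlocks136Ls 1 26 = true := by
  decide +kernel

set_option maxHeartbeats 0 in
/-- Row 27 of `Dn/Ls` is row 27 of `D` (odd blocks, `nb = 136`). [folklore] -/
theorem checkDnRow1_27_weilBlocks136 : weilBlocks136Base.checkDnRow weilBlocks136Dn weilBlocks136Ls 1 27 = true := by
  decide +kernel


end Summit.RiemannHypothesis.RiemannHypothesis.Theorems.EvenWinsBeyondArch
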